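import Summits.HodgeConjecture.HodgeConjecture.Theorems.Ring2WeilCoverageWeilGramLevel21Principal
import Summits.HodgeConjecture.HodgeConjecture.Theorems.Ring2WeilCoverageCyclotomicTwentyOneSignatures
import HarnessLib

/-!
# Weil-type family coverage — THE COMPONENTS OF THE WEIL-TYPE `ℤ[ζ₂₁]`-SIXFOLDS, III: `K_d = ℚ(√−7)`
# (`s₇ = 1 + 2(ζ³ + ζ⁶ + ζ¹²)`, the Gauss sum of `ζ₇ = ζ³`): principal-type Gram determinant `−21952 = −7·56²` —
# RIGHT sign, SPLIT class: the principally polarised Weil-type `ℤ[ζ₂₁]`-sixfolds for `ℚ(√−7)` lie on row R0 / W6.7.1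

research route conditional on HC_CM; not a corollary; Q11.4-sentence-2 already refuted in dim ≥ 3.

Ring 2, WEIL-TYPE FAMILY-COVERAGE CENSUS (`HOME/WEIL-FAMILY-COVERAGE.md` `## b01`, blocks b01.35 (the YES row
`(ℚ(ζ₂₁), √−7)`, W6.7.1 = the class of the Fermat sixfold `(42; 1, 14, 27)`), b01.41 (C) «on the five YES rows the
principal gives `a = +1` (split, b02.1 (F3))», S-pencil there), part 100 of the `Ring2WeilCoverage*` series; continues
parts 98/99 (frame `θ^i`, `ξ = ζ⁵/Φ₂₁′(ζ)`).

* §0 `s₇ = 1 + 2(ζ³ + ζ⁶ + ζ¹²)` is skew with `s₇² = −7`.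
* §1 `(E_ξ, s₇)`: eleven traces, **`det a = −21952 = −7·56²`**.
* §2 **EVERY skew `ζ′` of principal type gives `−21952`** (THEOREM L (i) at `21`); such `Φ`-positive `ζ′` exist on
  every `ℚ(√−7)`-balanced `Φ` (`exists_principal_twentyOne`, parts 8/11: THEOREM L (ii) at `21`) — CENSUS FORM; class
  **`[−21952] = [−1]·[7·56²] = splitDiscriminantClass 3 7`** (`7 ∈ Nm(ℚ(√−7))`), right sign `(−1)³ det a > 0`:
  **the principally polarised Weil-type `ℤ[ζ₂₁]`-CM sixfolds for `ℚ(√−7)` lie on the SPLIT component** — pub-hsemireg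
  row R0 for `ℚ(√−7)`, census row W6.7.1; b02.1 (F3) «`𝒪_K`-linear + principal ⟹ split» for these points, kernel.

HONEST FRAMING as parts 98/99; `HC_CM` is used nowhere.  No `def`, no named fact, no `sorry`.  Certificates from
`work/py/gen6.py` + `lev21.py`, re-verified by `linear_combination`.

References: [cite: vanGeemen1994HodgeAV, Lemma 5.2 (2)–(4), 5.4 and (5.4.1)]; [cite: Shimura1998, §14.3 Prop. 4–5,
pp. 103–104]; census b01.35, b01.41 (C) (seat-derived).
-/

noncomputable section

open Polynomial NumberField Module
open scoped nonZeroDivisors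

namespace Summit.HodgeConjecture.Ring2WeilCoverage.WeilGramLevel21SqrtNegSeven

open Literature.AlgebraicGeometry.VanGeemen1994 (weilField weilNormResidueGroup)
open Literature.AlgebraicGeometry.Motives (CMType normUnitsSubgroup)
open Literature.NumberTheory.ComplexMultiplication
open Summit.HodgeConjecture.Ring2WeilCoverage.TraceGramDeterminant (trace_aeval_zeta_mul_inv)
open Summit.HodgeConjecture.Ring2WeilCoverage.WeilGramCMPoint
open Summit.HodgeConjecture.Ring2WeilCoverage.RealUnitNormHalfSystems (complexConj_eq_inv)
open Summit.HodgeConjecture.Ring2WeilCoverage.CyclotomicPrincipalObstruction (complexConj_xi)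
open Summit.HodgeConjecture.Ring2WeilCoverage.CyclotomicDifferent (isOfType_one_xi_top xi_ne_zero)
open Summit.HodgeConjecture.HodgeConjecture.Ring2.WeilCoverage (mk_neg_eq_split_of_odd mk_neg_ne_split_of_odd
  mem_normUnitsSubgroup_of_sq_add_mul_sq)
open Summit.HodgeConjecture.HodgeConjecture.Ring2.Hypotheses (splitDiscriminantClass)
open Summit.HodgeConjecture.Ring2WeilCoverage.WeilGramLevel21
open Summit.HodgeConjecture.Ring2WeilCoverage.WeilGramLevel21Principal
open Summit.HodgeConjecture.Ring2WeilCoverage.RealQuadraticUnitNorm (norm_realUnits_pos_twentyOne)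
open Summit.HodgeConjecture.Ring2WeilCoverage.CyclotomicTwentyOneSignatures (exists_principal_twentyOne)
variable {K : Type} [Field K] [NumberField K] {ζ : K}

/-- `𝐞(t) = exp(2πi t/n) ∈ ℂ` (`ZMod.toCircle`). -/
local notation3 (prettyPrint := false) "𝐞 " t:max => ((ZMod.toCircle t : Circle) : ℂ)

/-- the residue set `S_Φ` read at level `21`. -/
local notation3 (prettyPrint := false) "SΦ[" Φ "," z "]" =>
  (Finset.univ.filter fun t : ZMod 21 => ∃ σ ∈ (Φ : CMType K).1, σ (z : K) = 𝐞 t)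

/-! ### §0 `s₇ = 1 + 2(ζ³ + ζ⁶ + ζ¹²)` -/

omit [NumberField K] in
/-- **`(1 + 2(ζ³ + ζ⁶ + ζ¹²))² = −7`**: `s = √−7 = 1 + 2(ζ³ + ζ⁶ + ζ¹²)` generates `K_d = ℚ(√−7) ⊂ ℚ(ζ_21)`. [folklore] -/
theorem sq_sqrtNegSeven (hζ : IsPrimitiveRoot ζ 21) : (1 + 2 * (ζ ^ 3 + ζ ^ 6 + ζ ^ 12)) ^ 2 = -7 := by
  have h21 : ζ ^ 21 = 1 := hζ.pow_eq_one
  linear_combination (8 + 8 * ζ + 8 * ζ^2 + 8 * ζ^3 + 8 * ζ^4 + 8 * ζ^5 + 8 * ζ^6) * cyc_twentyOne hζ +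
    (4 * ζ^3) * h21

/-- **`s = √−7 = 1 + 2(ζ³ + ζ⁶ + ζ¹²)` is skew** (`s^ρ = −s`). [folklore] -/
theorem complexConj_sqrtNegSeven [IsCMField K] (hζ : IsPrimitiveRoot ζ 21) :
    IsCMField.complexConj K (1 + 2 * (ζ ^ 3 + ζ ^ 6 + ζ ^ 12)) = -(1 + 2 * (ζ ^ 3 + ζ ^ 6 + ζ ^ 12)) := by
  simp only [map_add, map_mul, map_pow, map_one, map_ofNat, complexConj_eq_inv hζ]
  rw [inv_pow_eq_pow hζ (show 3 + 18 = 21 by norm_num), inv_pow_eq_pow hζ (show 6 + 15 = 21 by norm_num), inv_pow_eq_pow hζ (show 12 + 9 = 21 by norm_num)]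
  linear_combination (2 + 2 * ζ + 2 * ζ^2 + 2 * ζ^3 + 2 * ζ^4 + 2 * ζ^5 + 2 * ζ^6) * cyc_twentyOne hζ

/-! ### §1 The principal-type form `(E_ξ, s₇)`: `det a = −21952` -/

/-- `Tr(ζ′sθ^0) = 2` for `ζ′ = ξ = ζ⁵/Φ₂₁′(ζ)`, `s = √−7 = 1 + 2(ζ³ + ζ⁶ + ζ¹²)`, `θ = ζ + ζ⁻¹` (Euler evaluation). research route conditional on HC_CM; not a corollary; Q11.4-sentence-2 already refuted in dim ≥ 3. [folklore] -/
theorem trace_xi_sqrtNegSeven_zero [IsCyclotomicExtension {21} ℚ K] (hζ : IsPrimitiveRoot ζ 21) :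
    Algebra.trace ℚ K ((ζ ^ 5 * (aeval ζ (derivative (cyclotomic 21 ℚ)))⁻¹) * (1 + 2 * (ζ ^ 3 + ζ ^ 6 + ζ ^ 12))) = 2 := by
  have hΦ := cyc_twentyOne hζ
  rw [trace_of_key₀ hζ (C (0 : ℚ) + C (0 : ℚ) * X + C (0 : ℚ) * X ^ 2 + C (-2 : ℚ) * X ^ 3 + C (0 : ℚ) * X ^ 4 + C (1 : ℚ) * X ^ 5 +
      C (0 : ℚ) * X ^ 6 + C (0 : ℚ) * X ^ 7 + C (2 : ℚ) * X ^ 8 + C (0 : ℚ) * X ^ 9 + C (-2 : ℚ) * X ^ 10 +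
      C (2 : ℚ) * X ^ 11) (by compute_degree) (by
    rw [aeval_poly₁₂]
    push_cast
    linear_combination ((aeval ζ (derivative (cyclotomic 21 ℚ)))⁻¹ * (2 * ζ^3 + 2 * ζ^4 + 2 * ζ^5)) * hΦ)]
  norm_num [coeff_X_pow, coeff_X, coeff_C, coeff_one]

/-- `Tr(ζ′sθ^1) = 0` for `ζ′ = ξ = ζ⁵/Φ₂₁′(ζ)`, `s = √−7 = 1 + 2(ζ³ + ζ⁶ + ζ¹²)`, `θ = ζ + ζ⁻¹` (Euler evaluation). research route conditional on HC_CM; not a corollary; Q11.4-sentence-2 already refuted in dim ≥ 3. [folklore] -/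
theorem trace_xi_sqrtNegSeven_one [IsCyclotomicExtension {21} ℚ K] (hζ : IsPrimitiveRoot ζ 21) :
    Algebra.trace ℚ K ((ζ ^ 5 * (aeval ζ (derivative (cyclotomic 21 ℚ)))⁻¹) * (1 + 2 * (ζ ^ 3 + ζ ^ 6 + ζ ^ 12)) * (ζ + ζ⁻¹)) = 0 := by
  have hΦ := cyc_twentyOne hζ
  rw [trace_of_key₁ hζ (C (-2 : ℚ) + C (2 : ℚ) * X + C (-2 : ℚ) * X ^ 2 + C (-2 : ℚ) * X ^ 3 + C (1 : ℚ) * X ^ 4 +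
      C (0 : ℚ) * X ^ 5 + C (-1 : ℚ) * X ^ 6 + C (2 : ℚ) * X ^ 7 + C (2 : ℚ) * X ^ 8 + C (-2 : ℚ) * X ^ 9 +
      C (2 : ℚ) * X ^ 10 + C (0 : ℚ) * X ^ 11) (by compute_degree) (by
    rw [aeval_poly₁₂]
    push_cast
    linear_combination ((aeval ζ (derivative (cyclotomic 21 ℚ)))⁻¹ * (2 * ζ + 2 * ζ^3 + 2 * ζ^4 + 4 * ζ^5 + 2 * ζ^6 + 2 * ζ^7)) * hΦ)]
  norm_num [coeff_X_pow, coeff_X, coeff_C, coeff_one]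

/-- `Tr(ζ′sθ^2) = 4` for `ζ′ = ξ = ζ⁵/Φ₂₁′(ζ)`, `s = √−7 = 1 + 2(ζ³ + ζ⁶ + ζ¹²)`, `θ = ζ + ζ⁻¹` (Euler evaluation). research route conditional on HC_CM; not a corollary; Q11.4-sentence-2 already refuted in dim ≥ 3. [folklore] -/
theorem trace_xi_sqrtNegSeven_two [IsCyclotomicExtension {21} ℚ K] (hζ : IsPrimitiveRoot ζ 21) :
    Algebra.trace ℚ K ((ζ ^ 5 * (aeval ζ (derivative (cyclotomic 21 ℚ)))⁻¹) * (1 + 2 * (ζ ^ 3 + ζ ^ 6 + ζ ^ 12)) * (ζ + ζ⁻¹) ^ 2) = 4 := by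
  have h21 : ζ ^ 21 = 1 := hζ.pow_eq_one
  have hΦ := cyc_twentyOne hζ
  rw [trace_of_key hζ (C (0 : ℚ) + C (-4 : ℚ) * X + C (2 : ℚ) * X ^ 2 + C (-3 : ℚ) * X ^ 3 + C (-2 : ℚ) * X ^ 4 +
      C (2 : ℚ) * X ^ 5 + C (2 : ℚ) * X ^ 6 + C (-1 : ℚ) * X ^ 7 + C (2 : ℚ) * X ^ 8 + C (4 : ℚ) * X ^ 9 +
      C (-4 : ℚ) * X ^ 10 + C (4 : ℚ) * X ^ 11) (by compute_degree) (by
    rw [aeval_poly₁₂]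
    push_cast
    linear_combination ((aeval ζ (derivative (cyclotomic 21 ℚ)))⁻¹ * (2 + 2 * ζ + 2 * ζ^2 + 4 * ζ^3 + 2 * ζ^4 + 6 * ζ^5 + 4 * ζ^6 + 4 * ζ^7)) * hΦ +
      ((aeval ζ (derivative (cyclotomic 21 ℚ)))⁻¹ * (2)) * h21)]
  norm_num [coeff_X_pow, coeff_X, coeff_C, coeff_one]

/-- `Tr(ζ′sθ^3) = 0` for `ζ′ = ξ = ζ⁵/Φ₂₁′(ζ)`, `s = √−7 = 1 + 2(ζ³ + ζ⁶ + ζ¹²)`, `θ = ζ + ζ⁻¹` (Euler evaluation). research route conditional on HC_CM; not a corollary; Q11.4-sentence-2 already refuted in dim ≥ 3. [folklore] -/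
theorem trace_xi_sqrtNegSeven_three [IsCyclotomicExtension {21} ℚ K] (hζ : IsPrimitiveRoot ζ 21) :
    Algebra.trace ℚ K ((ζ ^ 5 * (aeval ζ (derivative (cyclotomic 21 ℚ)))⁻¹) * (1 + 2 * (ζ ^ 3 + ζ ^ 6 + ζ ^ 12)) * (ζ + ζ⁻¹) ^ 3) = 0 := by
  have h21 : ζ ^ 21 = 1 := hζ.pow_eq_one
  have hΦ := cyc_twentyOne hζ
  rw [trace_of_key hζ (C (-8 : ℚ) + C (6 : ℚ) * X + C (-7 : ℚ) * X ^ 2 + C (-4 : ℚ) * X ^ 3 + C (3 : ℚ) * X ^ 4 +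
      C (0 : ℚ) * X ^ 5 + C (-3 : ℚ) * X ^ 6 + C (4 : ℚ) * X ^ 7 + C (7 : ℚ) * X ^ 8 + C (-6 : ℚ) * X ^ 9 +
      C (8 : ℚ) * X ^ 10 + C (0 : ℚ) * X ^ 11) (by compute_degree) (by
    rw [aeval_poly₁₂]
    push_cast
    linear_combination ((aeval ζ (derivative (cyclotomic 21 ℚ)))⁻¹ * (6 + 6 * ζ + 8 * ζ^2 + 10 * ζ^3 + 4 * ζ^4 + 10 * ζ^5 + 6 * ζ^6 + 6 * ζ^7)) * hΦ +
      ((aeval ζ (derivative (cyclotomic 21 ℚ)))⁻¹ * (6 + 2 * ζ^2)) * h21)]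
  norm_num [coeff_X_pow, coeff_X, coeff_C, coeff_one]

/-- `Tr(ζ′sθ^4) = 16` for `ζ′ = ξ = ζ⁵/Φ₂₁′(ζ)`, `s = √−7 = 1 + 2(ζ³ + ζ⁶ + ζ¹²)`, `θ = ζ + ζ⁻¹` (Euler evaluation). research route conditional on HC_CM; not a corollary; Q11.4-sentence-2 already refuted in dim ≥ 3. [folklore] -/
theorem trace_xi_sqrtNegSeven_four [IsCyclotomicExtension {21} ℚ K] (hζ : IsPrimitiveRoot ζ 21) :
    Algebra.trace ℚ K ((ζ ^ 5 * (aeval ζ (derivative (cyclotomic 21 ℚ)))⁻¹) * (1 + 2 * (ζ ^ 3 + ζ ^ 6 + ζ ^ 12)) * (ζ + ζ⁻¹) ^ 4) = 16 := by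
  have h21 : ζ ^ 21 = 1 := hζ.pow_eq_one
  have hΦ := cyc_twentyOne hζ
  rw [trace_of_key hζ (C (-2 : ℚ) + C (-15 : ℚ) * X + C (10 : ℚ) * X ^ 2 + C (-12 : ℚ) * X ^ 3 + C (-4 : ℚ) * X ^ 4 +
      C (8 : ℚ) * X ^ 5 + C (4 : ℚ) * X ^ 6 + C (-4 : ℚ) * X ^ 7 + C (6 : ℚ) * X ^ 8 + C (15 : ℚ) * X ^ 9 +
      C (-14 : ℚ) * X ^ 10 + C (16 : ℚ) * X ^ 11) (by compute_degree) (by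
    rw [aeval_poly₁₂]
    push_cast
    linear_combination ((aeval ζ (derivative (cyclotomic 21 ℚ)))⁻¹ * (12 + 12 * ζ + 20 * ζ^2 + 8 * ζ^3 + 12 * ζ^4 + 20 * ζ^5 + 10 * ζ^6 +
        10 * ζ^7)) * hΦ +
      ((aeval ζ (derivative (cyclotomic 21 ℚ)))⁻¹ * (12 + 8 * ζ^2 + 2 * ζ^4)) * h21)]
  norm_num [coeff_X_pow, coeff_X, coeff_C, coeff_one]

/-- `Tr(ζ′sθ^5) = 4` for `ζ′ = ξ = ζ⁵/Φ₂₁′(ζ)`, `s = √−7 = 1 + 2(ζ³ + ζ⁶ + ζ¹²)`, `θ = ζ + ζ⁻¹` (Euler evaluation). research route conditional on HC_CM; not a corollary; Q11.4-sentence-2 already refuted in dim ≥ 3. [folklore] -/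
theorem trace_xi_sqrtNegSeven_five [IsCyclotomicExtension {21} ℚ K] (hζ : IsPrimitiveRoot ζ 21) :
    Algebra.trace ℚ K ((ζ ^ 5 * (aeval ζ (derivative (cyclotomic 21 ℚ)))⁻¹) * (1 + 2 * (ζ ^ 3 + ζ ^ 6 + ζ ^ 12)) * (ζ + ζ⁻¹) ^ 5) = 4 := by
  have h21 : ζ ^ 21 = 1 := hζ.pow_eq_one
  have hΦ := cyc_twentyOne hζ
  rw [trace_of_key hζ (C (-33 : ℚ) + C (24 : ℚ) * X + C (-25 : ℚ) * X ^ 2 + C (-12 : ℚ) * X ^ 3 + C (12 : ℚ) * X ^ 4 +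
      C (2 : ℚ) * X ^ 5 + C (-12 : ℚ) * X ^ 6 + C (8 : ℚ) * X ^ 7 + C (29 : ℚ) * X ^ 8 + C (-24 : ℚ) * X ^ 9 +
      C (29 : ℚ) * X ^ 10 + C (4 : ℚ) * X ^ 11) (by compute_degree) (by
    rw [aeval_poly₁₂]
    push_cast
    linear_combination ((aeval ζ (derivative (cyclotomic 21 ℚ)))⁻¹ * (22 + 22 * ζ + 42 * ζ^2 + 20 * ζ^3 + 30 * ζ^4 + 44 * ζ^5 + 22 * ζ^6 +
        20 * ζ^7)) * hΦ +
      ((aeval ζ (derivative (cyclotomic 21 ℚ)))⁻¹ * (22 + 20 * ζ^2 + 10 * ζ^4 + 2 * ζ^6)) * h21)]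
  norm_num [coeff_X_pow, coeff_X, coeff_C, coeff_one]

/-- `Tr(ζ′sθ^6) = 66` for `ζ′ = ξ = ζ⁵/Φ₂₁′(ζ)`, `s = √−7 = 1 + 2(ζ³ + ζ⁶ + ζ¹²)`, `θ = ζ + ζ⁻¹` (Euler evaluation). research route conditional on HC_CM; not a corollary; Q11.4-sentence-2 already refuted in dim ≥ 3. [folklore] -/
theorem trace_xi_sqrtNegSeven_six [IsCyclotomicExtension {21} ℚ K] (hζ : IsPrimitiveRoot ζ 21) :
    Algebra.trace ℚ K ((ζ ^ 5 * (aeval ζ (derivative (cyclotomic 21 ℚ)))⁻¹) * (1 + 2 * (ζ ^ 3 + ζ ^ 6 + ζ ^ 12)) * (ζ + ζ⁻¹) ^ 6) = 66 := by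
  have h21 : ζ ^ 21 = 1 := hζ.pow_eq_one
  have hΦ := cyc_twentyOne hζ
  rw [trace_of_key hζ (C (-13 : ℚ) + C (-54 : ℚ) * X + C (45 : ℚ) * X ^ 2 + C (-50 : ℚ) * X ^ 3 + C (-6 : ℚ) * X ^ 4 +
      C (33 : ℚ) * X ^ 5 + C (6 : ℚ) * X ^ 6 + C (-16 : ℚ) * X ^ 7 + C (21 : ℚ) * X ^ 8 + C (54 : ℚ) * X ^ 9 +
      C (-53 : ℚ) * X ^ 10 + C (66 : ℚ) * X ^ 11) (by compute_degree) (by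
    rw [aeval_poly₁₂]
    push_cast
    linear_combination ((aeval ζ (derivative (cyclotomic 21 ℚ)))⁻¹ * (42 + 42 * ζ + 84 * ζ^2 + 42 * ζ^3 + 72 * ζ^4 + 31 * ζ^5 + 56 * ζ^6 +
        44 * ζ^7 + 2 * ζ^8)) * hΦ +
      ((aeval ζ (derivative (cyclotomic 21 ℚ)))⁻¹ * (42 + 42 * ζ^2 + 30 * ζ^4 + 12 * ζ^6 + 2 * ζ^8)) * h21)]
  norm_num [coeff_X_pow, coeff_X, coeff_C, coeff_one]

/-- `Tr(ζ′sθ^7) = 26` for `ζ′ = ξ = ζ⁵/Φ₂₁′(ζ)`, `s = √−7 = 1 + 2(ζ³ + ζ⁶ + ζ¹²)`, `θ = ζ + ζ⁻¹` (Euler evaluation). research route conditional on HC_CM; not a corollary; Q11.4-sentence-2 already refuted in dim ≥ 3. [folklore] -/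
theorem trace_xi_sqrtNegSeven_seven [IsCyclotomicExtension {21} ℚ K] (hζ : IsPrimitiveRoot ζ 21) :
    Algebra.trace ℚ K ((ζ ^ 5 * (aeval ζ (derivative (cyclotomic 21 ℚ)))⁻¹) * (1 + 2 * (ζ ^ 3 + ζ ^ 6 + ζ ^ 12)) * (ζ + ζ⁻¹) ^ 7) = 26 := by
  have h21 : ζ ^ 21 = 1 := hζ.pow_eq_one
  have hΦ := cyc_twentyOne hζ
  rw [trace_of_key hζ (C (-133 : ℚ) + C (98 : ℚ) * X + C (-91 : ℚ) * X ^ 2 + C (-40 : ℚ) * X ^ 3 + C (49 : ℚ) * X ^ 4 +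
      C (13 : ℚ) * X ^ 5 + C (-49 : ℚ) * X ^ 6 + C (14 : ℚ) * X ^ 7 + C (117 : ℚ) * X ^ 8 + C (-98 : ℚ) * X ^ 9 +
      C (107 : ℚ) * X ^ 10 + C (26 : ℚ) * X ^ 11) (by compute_degree) (by
    rw [aeval_poly₁₂]
    push_cast
    linear_combination ((aeval ζ (derivative (cyclotomic 21 ℚ)))⁻¹ * (84 + 86 * ζ + 170 * ζ^2 + 86 * ζ^3 + 156 * ζ^4 + 73 * ζ^5 + 115 * ζ^6 +
        99 * ζ^7 + 14 * ζ^8)) * hΦ +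
      ((aeval ζ (derivative (cyclotomic 21 ℚ)))⁻¹ * (84 + 2 * ζ + 84 * ζ^2 + 72 * ζ^4 + 42 * ζ^6 + 14 * ζ^8 + 2 * ζ^10)) * h21)]
  norm_num [coeff_X_pow, coeff_X, coeff_C, coeff_one]

/-- `Tr(ζ′sθ^8) = 266` for `ζ′ = ξ = ζ⁵/Φ₂₁′(ζ)`, `s = √−7 = 1 + 2(ζ³ + ζ⁶ + ζ¹²)`, `θ = ζ + ζ⁻¹` (Euler evaluation). research route conditional on HC_CM; not a corollary; Q11.4-sentence-2 already refuted in dim ≥ 3. [folklore] -/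
theorem trace_xi_sqrtNegSeven_eight [IsCyclotomicExtension {21} ℚ K] (hζ : IsPrimitiveRoot ζ 21) :
    Algebra.trace ℚ K ((ζ ^ 5 * (aeval ζ (derivative (cyclotomic 21 ℚ)))⁻¹) * (1 + 2 * (ζ ^ 3 + ζ ^ 6 + ζ ^ 12)) * (ζ + ζ⁻¹) ^ 8) = 266 := by
  have h21 : ζ ^ 21 = 1 := hζ.pow_eq_one
  have hΦ := cyc_twentyOne hζ
  rw [trace_of_key hζ (C (-61 : ℚ) + C (-198 : ℚ) * X + C (191 : ℚ) * X ^ 2 + C (-201 : ℚ) * X ^ 3 + C (-1 : ℚ) * X ^ 4 +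
      C (133 : ℚ) * X ^ 5 + C (1 : ℚ) * X ^ 6 + C (-65 : ℚ) * X ^ 7 + C (75 : ℚ) * X ^ 8 + C (198 : ℚ) * X ^ 9 +
      C (-205 : ℚ) * X ^ 10 + C (266 : ℚ) * X ^ 11) (by compute_degree) (by
    rw [aeval_poly₁₂]
    push_cast
    linear_combination ((aeval ζ (derivative (cyclotomic 21 ℚ)))⁻¹ * (169 + 185 * ζ + 353 * ζ^2 + 186 * ζ^3 + 326 * ζ^4 + 159 * ζ^5 +
        271 * ζ^6 - 46 * ζ^7 + 56 * ζ^8)) * hΦ +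
      ((aeval ζ (derivative (cyclotomic 21 ℚ)))⁻¹ * (169 + 16 * ζ + 168 * ζ^2 + 2 * ζ^3 + 156 * ζ^4 + 114 * ζ^6 + 56 * ζ^8 +
        16 * ζ^10 + 2 * ζ^12)) * h21)]
  norm_num [coeff_X_pow, coeff_X, coeff_C, coeff_one]

/-- `Tr(ζ′sθ^9) = 122` for `ζ′ = ξ = ζ⁵/Φ₂₁′(ζ)`, `s = √−7 = 1 + 2(ζ³ + ζ⁶ + ζ¹²)`, `θ = ζ + ζ⁻¹` (Euler evaluation). research route conditional on HC_CM; not a corollary; Q11.4-sentence-2 already refuted in dim ≥ 3. [folklore] -/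
theorem trace_xi_sqrtNegSeven_nine [IsCyclotomicExtension {21} ℚ K] (hζ : IsPrimitiveRoot ζ 21) :
    Algebra.trace ℚ K ((ζ ^ 5 * (aeval ζ (derivative (cyclotomic 21 ℚ)))⁻¹) * (1 + 2 * (ζ ^ 3 + ζ ^ 6 + ζ ^ 12)) * (ζ + ζ⁻¹) ^ 9) = 122 := by
  have h21 : ζ ^ 21 = 1 := hζ.pow_eq_one
  have hΦ := cyc_twentyOne hζ
  rw [trace_of_key hζ (C (-525 : ℚ) + C (396 : ℚ) * X + C (-338 : ℚ) * X ^ 2 + C (-137 : ℚ) * X ^ 3 + C (198 : ℚ) * X ^ 4 +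
      C (61 : ℚ) * X ^ 5 + C (-198 : ℚ) * X ^ 6 + C (15 : ℚ) * X ^ 7 + C (460 : ℚ) * X ^ 8 +
      C (-396 : ℚ) * X ^ 9 + C (403 : ℚ) * X ^ 10 + C (122 : ℚ) * X ^ 11) (by compute_degree) (by
    rw [aeval_poly₁₂]
    push_cast
    linear_combination ((aeval ζ (derivative (cyclotomic 21 ℚ)))⁻¹ * (333 + 405 * ζ + 742 * ζ^2 + 427 * ζ^3 + 679 * ζ^4 + 345 * ζ^5 +
        597 * ζ^6 - 51 * ζ^7 + 46 * ζ^8)) * hΦ +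
      ((aeval ζ (derivative (cyclotomic 21 ℚ)))⁻¹ * (333 + 72 * ζ + 337 * ζ^2 + 18 * ζ^3 + 324 * ζ^4 + 2 * ζ^5 + 270 * ζ^6 +
        170 * ζ^8 + 72 * ζ^10 + 18 * ζ^12 + 2 * ζ^14)) * h21)]
  norm_num [coeff_X_pow, coeff_X, coeff_C, coeff_one]

/-- `Tr(ζ′sθ^10) = 1050` for `ζ′ = ξ = ζ⁵/Φ₂₁′(ζ)`, `s = √−7 = 1 + 2(ζ³ + ζ⁶ + ζ¹²)`, `θ = ζ + ζ⁻¹` (Euler evaluation). research route conditional on HC_CM; not a corollary; Q11.4-sentence-2 already refuted in dim ≥ 3. [folklore] -/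
theorem trace_xi_sqrtNegSeven_ten [IsCyclotomicExtension {21} ℚ K] (hζ : IsPrimitiveRoot ζ 21) :
    Algebra.trace ℚ K ((ζ ^ 5 * (aeval ζ (derivative (cyclotomic 21 ℚ)))⁻¹) * (1 + 2 * (ζ ^ 3 + ζ ^ 6 + ζ ^ 12)) * (ζ + ζ⁻¹) ^ 10) = 1050 := by
  have h21 : ζ ^ 21 = 1 := hζ.pow_eq_one
  have hΦ := cyc_twentyOne hζ
  rw [trace_of_key hζ (C (-251 : ℚ) + C (-741 : ℚ) * X + C (784 : ℚ) * X ^ 2 + C (-787 : ℚ) * X ^ 3 + C (46 : ℚ) * X ^ 4 +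
      C (525 : ℚ) * X ^ 5 + C (-46 : ℚ) * X ^ 6 + C (-263 : ℚ) * X ^ 7 + C (266 : ℚ) * X ^ 8 +
      C (741 : ℚ) * X ^ 9 + C (-799 : ℚ) * X ^ 10 + C (1050 : ℚ) * X ^ 11) (by compute_degree) (by
    rw [aeval_poly₁₂]
    push_cast
    linear_combination ((aeval ζ (derivative (cyclotomic 21 ℚ)))⁻¹ * (-411 - 171 * ζ + 499 * ζ^2 + 1000 * ζ^3 + 1421 * ζ^4 + 772 * ζ^5 +
        1276 * ζ^6 + 1038 * ζ^7 + 1219 * ζ^8)) * hΦ +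
      ((aeval ζ (derivative (cyclotomic 21 ℚ)))⁻¹ * (-411 + 240 * ζ + 670 * ζ^2 + 90 * ζ^3 + 661 * ζ^4 + 20 * ζ^5 + 594 * ζ^6 +
        2 * ζ^7 + 440 * ζ^8 + 242 * ζ^10 + 90 * ζ^12 + 20 * ζ^14 + 2 * ζ^16)) * h21)]
  norm_num [coeff_X_pow, coeff_X, coeff_C, coeff_one]

/-- **The Gram datum `a` of `(E_ζ′, s)` in the real frame `θ^i` (`i < 6`)** for `ζ′ = ξ = ζ⁵/Φ₂₁′(ζ)` (principal type (1)),
`s = √−7 = 1 + 2(ζ³ + ζ⁶ + ζ¹²)`: the integer Hankel matrix `(−Tr(ζ′sθ^{i+j}))ᵢⱼ` (and `b = 0`, part 82 `hb_eq_zero`).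
research route conditional on HC_CM; not a corollary; Q11.4-sentence-2 already refuted in dim ≥ 3. [cite: vanGeemen1994HodgeAV, Lemma 5.2 (2)–(3)] -/
theorem realPart_xi_sqrtNegSeven [IsCyclotomicExtension {21} ℚ K] [IsCMField K] (hζ : IsPrimitiveRoot ζ 21)
    {x : Fin 6 → K} (hx : ∀ i, x i = (ζ + ζ⁻¹) ^ (i : ℕ)) {a : Matrix (Fin 6) (Fin 6) ℚ}
    (ha : ∀ i j, a i j = Algebra.trace ℚ K ((ζ ^ 5 * (aeval ζ (derivative (cyclotomic 21 ℚ)))⁻¹) * x i * IsCMField.complexConj K ((1 + 2 * (ζ ^ 3 + ζ ^ 6 + ζ ^ 12)) * x j))) :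
    a = !![-2, 0, -4, 0, -16, -4; 0, -4, 0, -16, -4, -66; -4, 0, -16, -4, -66, -26; 0, -16, -4, -66, -26, -266; -16, -4, -66, -26, -266, -122; -4, -66, -26, -266, -122, -1050] := by
  rw [ha_eq (complexConj_sqrtNegSeven hζ) (complexConj_thetaFrame hζ hx) ha]
  ext i j
  simp only [Matrix.of_apply, hx, ← pow_add]
  fin_cases i <;> fin_cases j <;> simp [trace_xi_sqrtNegSeven_zero hζ, trace_xi_sqrtNegSeven_one hζ, trace_xi_sqrtNegSeven_two hζ, trace_xi_sqrtNegSeven_three hζ, trace_xi_sqrtNegSeven_four hζ, trace_xi_sqrtNegSeven_five hζ,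
    trace_xi_sqrtNegSeven_six hζ, trace_xi_sqrtNegSeven_seven hζ, trace_xi_sqrtNegSeven_eight hζ, trace_xi_sqrtNegSeven_nine hζ, trace_xi_sqrtNegSeven_ten hζ]

/-- **`det a = -21952`** for `ζ′ = ξ = ζ⁵/Φ₂₁′(ζ)`, `s = √−7 = 1 + 2(ζ³ + ζ⁶ + ζ¹²)` (frame `θ^i`, `i < 6`). research route conditional on HC_CM; not a corollary; Q11.4-sentence-2 already refuted in dim ≥ 3. [cite: vanGeemen1994HodgeAV, Lemma 5.2 (3)] -/
theorem det_realPart_xi_sqrtNegSeven [IsCyclotomicExtension {21} ℚ K] [IsCMField K] (hζ : IsPrimitiveRoot ζ 21)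
    {x : Fin 6 → K} (hx : ∀ i, x i = (ζ + ζ⁻¹) ^ (i : ℕ)) {a : Matrix (Fin 6) (Fin 6) ℚ}
    (ha : ∀ i j, a i j = Algebra.trace ℚ K ((ζ ^ 5 * (aeval ζ (derivative (cyclotomic 21 ℚ)))⁻¹) * x i * IsCMField.complexConj K ((1 + 2 * (ζ ^ 3 + ζ ^ 6 + ζ ^ 12)) * x j))) :
    a.det = -21952 := by
  rw [realPart_xi_sqrtNegSeven hζ hx ha]
  simp [Matrix.det_succ_row_zero, Fin.sum_univ_succ, Fin.succAbove, Matrix.submatrix]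
  norm_num

/-! ### §2 Invariance, census form, class: SPLIT (row R0 / W6.7.1) -/

/-- **For EVERY skew `ζ′` of PRINCIPAL type on `ℤ[ζ_21]` (`IsOfType 1 ζ′ ⊤`; `ζ′ = uξ`, `u` a real unit, `N(u) = 1`
by THEOREM L (i) at `21`) the Gram determinant of `(E_ζ′, s₇)` in the frame `θ^i` is `-21952`** (such `Φ`-positive `ζ′` exist on every `ℚ(√−7)`-balanced `Φ`, `exists_principal_twentyOne`): the SPLIT row R0 for `ℚ(√−7)` (census W6.7.1 `= (3, ℚ(√−7), 1)`);
`(−1)³ det a > 0`, the right sign for Weil signature `(3,3)` [vG94 5.2 (4)].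
research route conditional on HC_CM; not a corollary; Q11.4-sentence-2 already refuted in dim ≥ 3. [cite: vanGeemen1994HodgeAV, Lemma 5.2 (3)–(4) and (5.4.1)] [cite: Shimura1998, §14.3 Prop. 5, p. 104] -/
theorem det_realPart_principal_sqrtNegSeven [IsCyclotomicExtension {21} ℚ K] [IsCMField K]
    (hζ : IsPrimitiveRoot ζ 21) {ζ' : K} (hζ' : IsCMField.complexConj K ζ' = -ζ')
    (hT : CMTypeLattice.IsOfType (1 : (FractionalIdeal (𝓞 K)⁰ K)ˣ) ζ' ⊤)
    {x : Fin 6 → K} (hx : ∀ i, x i = (ζ + ζ⁻¹) ^ (i : ℕ)) {a : Matrix (Fin 6) (Fin 6) ℚ}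
    (ha : ∀ i j, a i j = Algebra.trace ℚ K (ζ' * x i * IsCMField.complexConj K ((1 + 2 * (ζ ^ 3 + ζ ^ 6 + ζ ^ 12)) * x j))) :
    a.det = -21952 := by
  obtain ⟨ωb, hωb⟩ := exists_basis_thetaPow hζ
  have hx' : ∀ i, x i = (ωb i : K) := fun i => (hx i).trans (hωb i).symm
  rw [det_realPart_eq_of_isOfType ωb (complexConj_sqrtNegSeven hζ) hx' (norm_realUnits_pos_twentyOne hζ)
    (complexConj_xi_twentyOne hζ) (xi_ne_zero hζ 5) hζ' (isOfType_one_xi_top hζ 5) hT (fun i j => rfl) ha]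
  exact det_realPart_xi_sqrtNegSeven hζ hx (fun i j => rfl)

open scoped Classical in
/-- **CENSUS FORM** (the YES row `(21, ℚ(√−7))`: existence in the tree + the determinant here): for every CM type `Φ` of
`ℚ(ζ_21)` balanced for `N_K = {5, 10, 13, 17, 19, 20}`, `ℂ^Φ/Φ(ℤ[ζ_21])` carries a `Φ`-positive divisor of PRINCIPAL type, and EVERY such
divisor has van Geemen Gram determinant `-21952` in the real frame `θ^i`: the SPLIT row R0 for `ℚ(√−7)` (census W6.7.1 `= (3, ℚ(√−7), 1)`).
research route conditional on HC_CM; not a corollary; Q11.4-sentence-2 already refuted in dim ≥ 3. [cite: vanGeemen1994HodgeAV, Lemma 5.2 (3)–(4) and (5.4.1)] [cite: Shimura1998, §14.3 Prop. 4–5, pp. 103–104] -/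
theorem exists_principal_sqrtNegSeven_det [IsCyclotomicExtension {21} ℚ K] [IsCMField K]
    (hζ : IsPrimitiveRoot ζ 21) (Φ : CMType K)
    (hbal : 2 * (SΦ[Φ, ζ] ∩ ({5, 10, 13, 17, 19, 20} : Finset (ZMod 21))).card = (SΦ[Φ, ζ]).card) :
    ∃ ζ' : K, IsCMField.complexConj K ζ' = -ζ' ∧ (∀ φ : Φ.1, 0 < (φ.1 ζ').im) ∧
      CMTypeLattice.IsOfType (1 : (FractionalIdeal (𝓞 K)⁰ K)ˣ) ζ' ⊤ ∧
      ∀ (x : Fin 6 → K), (∀ i, x i = (ζ + ζ⁻¹) ^ (i : ℕ)) → ∀ a : Matrix (Fin 6) (Fin 6) ℚ,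
        (∀ i j, a i j = Algebra.trace ℚ K (ζ' * x i * IsCMField.complexConj K ((1 + 2 * (ζ ^ 3 + ζ ^ 6 + ζ ^ 12)) * x j))) →
        a.det = -21952 := by
  obtain ⟨ζ', h1, h2, h3⟩ := exists_principal_twentyOne hζ Φ hbal
  exact ⟨ζ', h1, h2, h3, fun x hx a ha => det_realPart_principal_sqrtNegSeven hζ h1 h3 hx ha⟩

/-- **`[-21952] = [−1]·[21952]` is the SPLIT class `splitDiscriminantClass 3 7` in `ℚˣ/Nm(ℚ(√−7)ˣ)`** (`21952 = 0² + 7·56² ∈ Nm`):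
the principally polarised Weil-type `ℤ[ζ₂₁]`-CM sixfolds for `ℚ(√−7)` lie on the SPLIT row R0 for `ℚ(√−7)` (census W6.7.1 `= (3, ℚ(√−7), 1)`) — b02.1 (F3) for these CM points, in the kernel.
research route conditional on HC_CM; not a corollary; Q11.4-sentence-2 already refuted in dim ≥ 3. [cite: vanGeemen1994HodgeAV, 5.4 and (5.4.1)] -/
theorem mk0_det_principal_sqrtNegSeven :
    (QuotientGroup.mk (Units.mk0 (-21952 : ℚ) (by norm_num)) : weilNormResidueGroup 7) = splitDiscriminantClass 3 7 :=
  mk_neg_eq_split_of_odd (by decide) (by norm_num : (21952 : ℚ) ≠ 0)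
    (mem_normUnitsSubgroup_of_sq_add_mul_sq _ (0 : ℚ) (56 : ℚ) (by norm_num))

end Summit.HodgeConjecture.Ring2WeilCoverage.WeilGramLevel21SqrtNegSeven

end
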